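import Literature.MathematicalPhysics.QuantumFieldTheory.QCDTransferMatrix

/-!
# Sketch — crux-ideate round 2, ideator 4, crux `stmt-QuantumFields-17498` (`ChiralGluonicCompletion`)

Card `norm-gap-cold-pressure` ("C1 is a norm gap plus a cold pressure"): the first checkable
statements of the line, over existing declarations.

* Abstract transfer-matrix calculus of the `(−1)^F`-twisted torus functional (pure linear algebra
  over `Matrix n n ℂ`): `pow_vacuum_add_thermal` (PROVED), `twistedTrace_split` (PROVED) — the
  four-term vacuum/thermal expansion behind the twisted-trace clustering bound — and the bound
  itself `TwistedClusterBound` (stated as a `Prop`; Hölder for the trace + `‖Γ‖ ≤ 1`).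
* The two stubs of the C1-node in tree vocabulary (`qcdTransferGap`, `qcdTransferLevel` of
  `Literature/…/QCDTransferMatrix.lean`): `UniformNormGap` (V) and `ColdPressure` (P₂), and the
  composition target `C1OfNormGapColdPressure` (the first lemma of the line as a `Prop`).
-/

noncomputable section

open Filter Matrix
open scoped Matrix.Norms.L2Operator ComplexOrder

namespace Summit.QuantumFields.QCD.Cruxes.ChiralGluonicCompletion.NormGapColdPressure

/-! ## §1 Abstract twisted-trace calculus -/

section Abstract

variable {n : Type*} [Fintype n] [DecidableEq n]

/-- Vacuum/thermal splitting of the normalised transfer operator `ρ = 𝕋/λ₀ = P + R`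
(`P` the vacuum projection, `PR = RP = 0`): `ρ^m = P + R^m` for `m ≥ 1`. -/
theorem pow_vacuum_add_thermal (P R : Matrix n n ℂ) (hP : P * P = P) (hPR : P * R = 0)
    (hRP : R * P = 0) {m : ℕ} (hm : 1 ≤ m) : (P + R) ^ m = P + R ^ m := by
  induction m, hm using Nat.le_induction with
  | base => simp
  | succ k hk ih =>
    have hRkP : R ^ k * P = 0 := by
      obtain ⟨j, rfl⟩ : ∃ j, k = j + 1 := ⟨k - 1, by omega⟩
      rw [pow_succ, Matrix.mul_assoc, hRP, Matrix.mul_zero]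
    rw [pow_succ, ih, Matrix.add_mul, Matrix.mul_add, Matrix.mul_add, hP, hPR, hRkP,
      ← pow_succ]
    simp

/-- The four-term expansion of the twisted two-time trace
`Tr[Γ ρ^{N−t} A ρ^t B] = Tr[Γ P A P B] + Tr[Γ P A R^t B] + Tr[Γ R^{N−t} A P B] + Tr[Γ R^{N−t} A R^t B]`
(vacuum × vacuum, vacuum–connected, and the two thermal terms). Pure ring algebra. -/
theorem twistedTrace_split (Γ P R A B : Matrix n n ℂ) (hP : P * P = P) (hPR : P * R = 0)
    (hRP : R * P = 0) {N t : ℕ} (ht : 1 ≤ t) (hNt : t + 1 ≤ N) :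
    (Γ * (P + R) ^ (N - t) * A * (P + R) ^ t * B).trace =
      (Γ * P * A * P * B).trace + (Γ * P * A * R ^ t * B).trace +
        (Γ * R ^ (N - t) * A * P * B).trace + (Γ * R ^ (N - t) * A * R ^ t * B).trace := by
  rw [pow_vacuum_add_thermal P R hP hPR hRP ht,
    pow_vacuum_add_thermal P R hP hPR hRP (show 1 ≤ N - t by omega)]
  simp only [Matrix.mul_add, Matrix.add_mul, Matrix.trace_add]
  ring

/-- **Twisted-trace clustering bound** (the abstract first lemma of the line; `‖·‖` is the `ℓ²`
operator norm of `Matrix.Norms.L2Operator`). Normalised transfer operator `ρ = P + R` with `P` the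
rank-one vacuum projection (`P² = P`, `P† = P`, `Tr P = 1`), thermal part `R ≥ 0` with
`PR = RP = 0`, fermion-parity twist `Γ` (`Γ† = Γ`, `Γ² = 1`, `ΓP = P`, `ΓR = RΓ`). Then for
`1 ≤ t`, `t + 1 ≤ N` the twisted two-time trace differs from its vacuum part by thermal terms
controlled by the operator norm `‖R‖` (the gap) and the thermal ENTROPY SUM `Re Tr R^{N−t}`
(the cold-pressure number):
`‖Tr[Γρ^{N−t}Aρ^tB] − Tr[ΓPAPB] − Tr[ΓPAR^tB]‖ ≤ ‖A‖‖B‖(‖R‖^{N−t} + Re Tr(R^{N−t}) · ‖R‖^t)`,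
while the vacuum-connected term obeys `‖Tr[ΓPAR^tB]‖ ≤ ‖A‖‖B‖‖R‖^t` and the twisted
normalisation `‖Tr[Γρ^N] − 1‖ ≤ Re Tr(R^N)`. (Hölder `|Tr[XY]| ≤ ‖X‖₁‖Y‖_op`, `‖Γ‖ = 1`,
`‖X‖₁ = Tr X` for `X ≥ 0`.) -/
def TwistedClusterBound : Prop :=
  ∀ (n : Type) [Fintype n] [DecidableEq n] (Γ P R A B : Matrix n n ℂ),
    P * P = P → P.IsHermitian → P.trace = 1 → R.PosSemidef → P * R = 0 → R * P = 0 →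
    Γ.IsHermitian → Γ * Γ = 1 → Γ * P = P → Commute Γ R →
    ∀ N t : ℕ, 1 ≤ t → t + 1 ≤ N →
      ‖(Γ * (P + R) ^ (N - t) * A * (P + R) ^ t * B).trace -
          (Γ * P * A * P * B).trace - (Γ * P * A * R ^ t * B).trace‖ ≤
        ‖A‖ * ‖B‖ * (‖R‖ ^ (N - t) + ((R ^ (N - t)).trace).re * ‖R‖ ^ t) ∧
      ‖(Γ * P * A * R ^ t * B).trace‖ ≤ ‖A‖ * ‖B‖ * ‖R‖ ^ t ∧
      ‖(Γ * (P + R) ^ N).trace - 1‖ ≤ ((R ^ N).trace).re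

end Abstract

/-! ## §2 The two stubs of the C1 node in tree vocabulary -/

section Stubs

open Literature.MathematicalPhysics.QuantumFieldTheory

variable {Nf : ℕ}

/-- Clause (i) of the hypothesis package (physical branch `m_f(k) > −1` eventually) — EXACTLY
Lüscher's positivity range `κ_f < 1/6` for the `r = 1` one-step transfer operator. -/
def ClauseI (reg : QCDRegularisation Nf) (m : Fin Nf → ℝ) : Prop :=
  ∀ f : Fin Nf, ∀ᶠ k in atTop, -1 < reg.mcrit k + reg.a k * m f / reg.Zm k

/-- Stub **(V) — UNIFORM NORM GAP**: along the bare trajectory of `reg` at renormalised masses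
`m`, the spectral gap of Lüscher's positive transfer operator on the spatial three-torus of side
`2S+1` is at least `a_k Δ` (lattice units), for all tori `S ≥ L_k`, eventually in `k`. A statement
in the POSITIVE-METRIC world (min–max levels `qcdTransferLevel`): no determinant sign, any `N_f`,
any mass splitting. This is the Yang–Mills-hard core γ1 in its sharpest form. -/
def UniformNormGap (reg : QCDRegularisation Nf) (m : Fin Nf → ℝ) : Prop :=
  ∃ Δ : ℝ, 0 < Δ ∧ ∀ᶠ k in atTop, ∀ S : ℕ, reg.L k ≤ S →
    reg.a k * Δ ≤ @qcdTransferGap Nf (reg.β k) (2 * S + 1) ⟨Nat.succ_ne_zero _⟩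
      (fun f => reg.mcrit k + reg.a k * m f / reg.Zm k)

/-- Stub **(P₂) — COLD PRESSURE at aspect ratio 2**: the thermal entropy sum
`θ = Σ_{n ≥ 1} (λ_n/λ₀)^{S+1} = Tr(𝕋/λ₀)^{S+1} − 1 = Z_AP(N_t = S+1, N_s = 2S+1)/λ₀^{S+1} − 1`
(`= exp(p V₃/T) − 1`, `p` the pressure at temperature `T = 1/(a_k(S+1)) ≤ 2 T_k → 0`) is bounded,
for all `S ≥ L_k`, eventually in `k`. A THERMODYNAMIC gap statement (no light or degenerate
infrared), sign-free, the currency of route `CounterexampleMustBeHot` (`F = (90/π²) p/T⁴`). -/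
def ColdPressure (reg : QCDRegularisation Nf) (m : Fin Nf → ℝ) : Prop :=
  ∃ C : ℝ, ∀ᶠ k in atTop, ∀ S : ℕ, reg.L k ≤ S →
    let θ : ℕ → ℝ := fun j =>
      (qcdTransferLevel Nf (2 * S + 1) (reg.β k) (fun f => reg.mcrit k + reg.a k * m f / reg.Zm k) (j + 1) /
          qcdTransferLevel Nf (2 * S + 1) (reg.β k) (fun f => reg.mcrit k + reg.a k * m f / reg.Zm k) 0) ^
        (S + 1)
    -- `Summable` is demanded explicitly: Mathlib's `tsum` of a non-summable family is the junk value `0`,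
    -- which would make the bound vacuous exactly when the entropy sum diverges.
    Summable θ ∧ ∑' j, θ j ≤ C

/-- **First lemma of the line (composition target of the C1 node)**: clause (i) (Lüscher
positivity) + (V) + (P₂) give the SIGNED, all-observable, all-volume lattice gap of `QCDOf` for the
regularisation's own scheme at `m` — via the twisted-trace representation
`qcdTorusExpect = Tr[(−1)^F 𝕋^{2S+1} ·]/Tr[(−1)^F 𝕋^{2S+1}]` (Smit (C.70); the route item the
`QCDTransferMatrix` docstring asks for) and `TwistedClusterBound`, with NO reweighting, NO
clause (iv), NO sign-defect expansion. -/
def C1OfNormGapColdPressure : Prop :=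
  ∀ (Nf : ℕ) (reg : QCDRegularisation Nf) (m : Fin Nf → ℝ), (∀ f, 0 < m f) →
    ClauseI reg m → UniformNormGap reg m → ColdPressure reg m →
      ∃ Δ > 0, (reg.scheme m 0 0).HasLatticeMassGap Δ

end Stubs

end Summit.QuantumFields.QCD.Cruxes.ChiralGluonicCompletion.NormGapColdPressure

end
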